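import Literature.Computability.AlgebraicComplexity.DeterminantalComplexity
import Literature.Computability.AlgebraicComplexity.DeterminantalComplexityProofs
import Literature.Computability.AlgebraicComplexity.DeterminantalConormalBound
import Literature.Computability.AlgebraicComplexity.DeterminantalConormalBoundMixed
import Literature.Computability.AlgebraicComplexity.StandardFamilies
import Summits.ValiantsHypothesis.ValiantsHypothesis.Theses.DetQP
import Summits.ValiantsHypothesis.ValiantsHypothesis.Theorems.DetQPDetqpSuperquadraticStubBezoutGrowth
import Summits.ValiantsHypothesis.ValiantsHypothesis.Theorems.DetQPDetqpSuperquadraticStubPolarPersistenceND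
import Summits.ValiantsHypothesis.ValiantsHypothesis.Theorems.DetQPDetqpSuperquadraticStubPolarCountND

/-!
# Crux `DetQP.DetqpSuperquadratic` (stmt-ValiantsHypothesis-0318), line `sectional-class-ladder` —
stub `stub_cruxOfSectionalWitness`: the reduction "sectional class witnesses ⇒ crux" as a closed theorem

The line reduces the crux `dc(per_n) ≥ n^(2+ε)` (for all large `n`) to ONE open statement about the
permanental hypersurface, the **sectional class witness** conjecture `SW` (registered stub
`stub_sectionalWitness` of the skeleton `Cruxes/DetqpSuperquadratic/Lines/sectional_class_ladder.lean`):
there are exponents `0 < θ < ε` such that for all large `n` some rung `k ≥ n^{1+ε}` carries a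
`(k+2)`-variable linear section `g = per_n ∘ L` (`L` homogeneous linear), ONE pencil/chart datum
`(a, b, c)` and a finite set `F` of at least `n^{(1-θ)k}` points of the polar set `T_g(a,b,c)`
(`Literature…polarSet`) each of which is a NON-DEGENERATE zero of the square polar system (the bordered
Hessian Jacobian displayed below is invertible).

This file lands the reduction itself, sorry-free, from tree theorems only:

* `stub_cruxOfSectionalWitness` : `SW → DetqpSuperquadratic`.

**Proof** (the ND route of the skeleton, lead c1's v2/v3 composition).  From `SW` take `ε, θ, n₀`; from
the growth lemma `stub_bezoutGrowth` (p97537) take `n₁`.  For `n ≥ max n₀ n₁` (and `n ≥ 1`; `n = 0` is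
trivial) let `m = dc(per_n)`, attained by `hasDetRepr_determinantalComplexity_holds`; determinantal
representations survive linear substitution, so the section `g = per_n ∘ L` has `HasDetRepr g m`
(`hasDetRepr_aeval_of_isHomogeneous_one`).  Sheshadri's two-kernel Bézout bound in its non-degenerate
form `stub_polarCountND` (p107629) gives a nonzero `Φ` such that every finite set of non-degenerate
polar points of `g` at a datum `u` with `Φ(u) ≠ 0` has at most `B(m, k+2)` elements; the certificate's
`F` persists, as a set of non-degenerate polar points of at least the same size, to such a datum
(`stub_polarPersistenceND`, p101995).  Hence `n^{(1-θ)k} ≤ |F| ≤ B(m, k+2)` with `k ≥ n^{1+ε}`, and the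
growth lemma yields `n^{2+(ε-θ)/2} ≤ m = dc(per_n)`.
-/

noncomputable section

-- `Summit.ValiantsHypothesis.ValiantsHypothesis.…` is the tree's mandated single-conjunct layout (Sub = Summit).
set_option linter.dupNamespace false

namespace Summit.ValiantsHypothesis.ValiantsHypothesis.Theorems.DetQPDetqpSuperquadratic

open MvPolynomial Matrix
open Literature.Computability.AlgebraicComplexity

/-- Determinantal representations survive substitution of homogeneous linear forms: if `f` has an
affine determinantal representation of size `m`, so has `aeval L f` for every family `L` of
homogeneous linear forms (entries stay of total degree `≤ 1`,
`HasDetRepr.totalDegree_aeval_le_of_le_one`; cf. `HasDetRepr.of_isProjection_holds`). [folklore] -/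
theorem hasDetRepr_aeval_of_isHomogeneous_one {σ τ : Type*} {f : MvPolynomial σ ℂ} {m : ℕ}
    (h : HasDetRepr f m) (L : σ → MvPolynomial τ ℂ) (hL : ∀ i, (L i).IsHomogeneous 1) :
    HasDetRepr (aeval L f) m := by
  obtain ⟨A, hA, rfl⟩ := h
  have hL1 : ∀ i, (L i).totalDegree ≤ 1 := fun i => (hL i).totalDegree_le
  refine ⟨(aeval L).mapMatrix A, fun i j => ?_, (AlgHom.map_det _ _).symm⟩
  rw [AlgHom.mapMatrix_apply, Matrix.map_apply]
  exact (HasDetRepr.totalDegree_aeval_le_of_le_one L hL1 _).trans (hA i j)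

/-- **Registered sub-goal `stub_cruxOfSectionalWitness` — the reduction "SW ⇒ crux" of line
`sectional-class-ladder`.**  If there are exponents `0 < θ < ε` such that for all large `n` some rung
`k ≥ n^{1+ε}` carries a `(k+2)`-variable homogeneous linear section `g = per_n ∘ L` of the permanent,
one pencil/chart datum `(a, b, c)` and a finite set `F` of at least `n^{(1-θ)k}` points of the polar
set of `g` at which the bordered Hessian Jacobian
`[[∂ᵢ∂ⱼ g(x), (aᵢ bᵢ)], [(∂ⱼ g(x); cⱼ), 0]]` is invertible (non-degenerate polar points), then
`dc(per_n) ≥ n^(2+ε')` for all large `n` with `ε' = (ε-θ)/2` (`DetQP.DetqpSuperquadratic`).  Composition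
of tree theorems: the attained representation of size `m = dc(per_n)`
(`hasDetRepr_determinantalComplexity_holds`) restricts to the section; Sheshadri's non-degenerate polar
count `stub_polarCountND` bounds non-degenerate polar points at data off a hypersurface `Φ = 0` by the
two-kernel Bézout number `B(m, k+2)`; the certificate persists to such a datum
(`stub_polarPersistenceND`); the growth lemma `stub_bezoutGrowth` extracts the exponent. [folklore] -/
theorem stub_cruxOfSectionalWitness :
    (∃ ε θ : ℝ, 0 < θ ∧ θ < ε ∧ ∃ n₀ : ℕ, ∀ n ≥ n₀, ∃ k : ℕ, (n : ℝ) ^ (1 + ε) ≤ (k : ℝ) ∧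
      ∃ L : Fin n × Fin n → MvPolynomial (Fin (k + 2)) ℂ, (∀ ij, (L ij).IsHomogeneous 1) ∧
        ∃ (a b c : Fin (k + 2) → ℂ) (F : Finset (Fin (k + 2) → ℂ)),
          (∀ x ∈ F, x ∈ polarSet (aeval L (perPoly (Fin n) ℂ)) a b c ∧
            (Matrix.fromBlocks
              (Matrix.of fun i j : Fin (k + 2) =>
                eval x (pderiv i (pderiv j (aeval L (perPoly (Fin n) ℂ)))))
              (Matrix.of fun (i : Fin (k + 2)) (l : Fin 2) => ![a i, b i] l)
              (Matrix.of fun (l : Fin 2) (j : Fin (k + 2)) =>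
                ![eval x (pderiv j (aeval L (perPoly (Fin n) ℂ))), c j] l)
              (0 : Matrix (Fin 2) (Fin 2) ℂ)).det ≠ 0) ∧
          (n : ℝ) ^ ((1 - θ) * (k : ℝ)) ≤ (F.card : ℝ)) →
    Summit.ValiantsHypothesis.ValiantsHypothesis.Theses.DetQP.DetqpSuperquadratic := by
  intro hSW
  obtain ⟨ε, θ, hθ, hθε, n₀, hW⟩ := hSW
  obtain ⟨n₁, hA⟩ := stub_bezoutGrowth ε θ hθ hθε
  refine ⟨(ε - θ) / 2, by linarith, max n₀ n₁, fun n hn => ?_⟩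
  have hn₀ : n₀ ≤ n := le_of_max_le_left hn
  have hn₁ : n₁ ≤ n := le_of_max_le_right hn
  set m := determinantalComplexity (perPoly (Fin n) ℂ) with hm_def
  rcases Nat.eq_zero_or_pos n with rfl | hnpos
  · have hexp : (2 + (ε - θ) / 2 : ℝ) ≠ 0 := by
      have : (0 : ℝ) < 2 + (ε - θ) / 2 := by linarith
      exact this.ne'
    rw [Nat.cast_zero, Real.zero_rpow hexp]
    exact Nat.cast_nonneg _
  obtain ⟨k, hk, L, hL, a, b, c, F, hF, hcard⟩ := hW n hn₀
  have hk1 : 1 ≤ k := by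
    have h1 : (1 : ℝ) ≤ (n : ℝ) ^ (1 + ε) :=
      Real.one_le_rpow (by exact_mod_cast hnpos) (by linarith)
    exact_mod_cast h1.trans hk
  -- the section `g = per_n ∘ L` is a form of degree `n` with `HasDetRepr g m`, `m = dc(per_n)`
  have hhom : (aeval L (perPoly (Fin n) ℂ)).IsHomogeneous n := by
    simpa using (perPoly_isHomogeneous (n := Fin n) (k := ℂ)).aeval L hL
  have hmrep : HasDetRepr (aeval L (perPoly (Fin n) ℂ)) m :=
    hasDetRepr_aeval_of_isHomogeneous_one (hasDetRepr_determinantalComplexity_holds _) L hL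
  -- Sheshadri's ND polar count off `Φ = 0`, and persistence of the certificate to such a datum
  obtain ⟨Φ, hΦ0, hΦ⟩ :=
    stub_polarCountND (N := k + 2) (by omega) (aeval L (perPoly (Fin n) ℂ)) n m hhom hmrep
  obtain ⟨u, hu, F', hFF', hF'⟩ :=
    stub_polarPersistenceND (aeval L (perPoly (Fin n) ℂ)) a b c F hF Φ hΦ0
  have hB : F'.card ≤ conormalBezout m (k + 2) := hΦ u hu F' hF'
  have h2 : (n : ℝ) ^ ((1 - θ) * (k : ℝ)) ≤ (conormalBezout m (k + 2) : ℝ) :=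
    hcard.trans (by exact_mod_cast hFF'.trans hB)
  -- growth lemma: `n^{2+(ε-θ)/2} ≤ m`
  exact hA n hn₁ k m hk h2

end Summit.ValiantsHypothesis.ValiantsHypothesis.Theorems.DetQPDetqpSuperquadratic
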